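import Summits.AtomisticToContinuum.BoseEinsteinCondensation.Theorems.BECThomsonPrincipleDensityResponseTruncationLimit
import Literature.MathematicalPhysics.QuantumManyBody.PeriodicHardCoreMaxFormBound
import HarnessLib

/-!
# Sub-goal `stub_truncationLimitHardCore` of line `force-balance-constitutive` (crux
# `BECThomsonPrinciple.DensityResponse`, item stmt-AtomisticToContinuum-9481): the truncation limit at fixed
# volume for HARD-CORE pair potentials with an integrable tail

The registered stub S4 `TruncationLimit` asks, for an admissible `v`, `N`, `L > 0` with
`E₀(v) = periodicGroundStateEnergy v N L < ∞` and `ε > 0`, for `n₁` with `E₀(v) ≤ E₀(min(v,n)) + ε` for all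
`n ≥ n₁`. `…TruncationLimit.lean` reduced it, at each `(v, N, L)`, to the maximal-form bound at `(v, N, L)`
(`truncationLimit_at_of_maxFormBound_at`) and closed the integrable case (`∫_{[0,L)^{3N}} W_v < ∞`). Here the
complementary physical case is closed with the Literature theorem
`periodicGroundStateEnergy_le_maxForm_of_hardCore` (`Literature/…/QuantumManyBody/PeriodicHardCoreMaxFormBound.lean`,
the Lieb–Yngvason hard-core-plus-tail class): `v = +∞` on `[0, a]` (`0 < a`, `2a < L`) and the tail
`v 𝟙_{(a,∞)}` has an integrable periodic interaction on the cell — in particular whenever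
`∫_{ℝ³} (v 𝟙_{(a,∞)})(|z|) dz < ∞`.

* `truncationLimit_at_of_hardCore` — cell form of the tail hypothesis, `a / L < 1/2`;
* `truncationLimit_at_of_hardCore_profile` — profile form `∫⁻ z, (Set.Ioi a).indicator v ‖z‖ ≠ ⊤`, `2a < L`;
* `stub_truncationLimitHardCore` — the registered sub-goal (universally quantified, verbatim the profile form).

NOT covered (as in the Literature file): non-integrability of `W_v` not coming from a solid core (`v = ⊤` on a
fat Cantor set of radii, or a finite non-`L¹` singularity), which needs capacity / trace theory.

References: [LSSY2005] Ch. 2 and App. A; B. Simon, *J. Operator Theory* 1 (1979) 37–47.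
-/

noncomputable section

namespace Summit.AtomisticToContinuum.BoseEinsteinCondensation.Cruxes.DensityResponse.ForceBalanceConstitutive

open MeasureTheory Filter UnitAddTorus
open scoped ENNReal NNReal BigOperators Topology InnerProductSpace
open Literature.MathematicalPhysics.QuantumManyBody.BoseGas
open Summit.AtomisticToContinuum.BoseEinsteinCondensation.Cruxes.StaticResponseBound.UvThomsonForceWave

-- The measure on `ℝ/ℤ` is the Haar PROBABILITY measure, as in `PeriodicFormDomain.lean` and `…TruncationLimit.lean`.
attribute [local instance] Literature.MathematicalPhysics.QuantumManyBody.BoseGas.formDomain_measureSpace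
  Literature.MathematicalPhysics.QuantumManyBody.BoseGas.formDomain_isProbabilityMeasure
  Literature.MathematicalPhysics.QuantumManyBody.BoseGas.formDomain_isProbabilityMeasure_pi

/-! ### The truncation limit for a hard core with integrable tail -/

/-- **`TruncationLimit` at `(v, N, L)` for a hard core with integrable tail (cell form).** If `v` is
admissible, `v = +∞` on `[0, a]` with `0 < a`, `a / L < 1/2`, the tail interaction
`W_{v 𝟙_{(a,∞)}} = ∑_{i<j} (v 𝟙_{(a,∞)})^per(xᵢ - xⱼ)` is integrable on `[0,L)^{3N}` and `E₀(v) < ∞`, then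
`E₀(v) ≤ E₀(min(v,n)) + ε` for all large `n` (`periodicGroundStateEnergy_le_maxForm_of_hardCore` fed into
`truncationLimit_at_of_maxFormBound_at`). [folklore] -/
theorem truncationLimit_at_of_hardCore {v : ℝ → ℝ≥0∞} (hv : IsRepulsiveFiniteRange v) {a : ℝ} (ha : 0 < a)
    (hcoreV : ∀ r : ℝ, 0 ≤ r → r ≤ a → v r = ⊤) {N : ℕ} {L : ℝ} (hL : 0 < L) (haL : a / L < 1 / 2)
    (htail : ∫⁻ X in cellN N L, periodicInteraction ((Set.Ioi a).indicator v) L X ≠ ⊤)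
    (hfin : periodicGroundStateEnergy v N L ≠ ⊤) {ε : ℝ} (hε : 0 < ε) :
    ∃ n₁ : ℕ, ∀ n : ℕ, n₁ ≤ n →
      (periodicGroundStateEnergy v N L).toReal ≤
        (periodicGroundStateEnergy (truncPotential v n) N L).toReal + ε :=
  truncationLimit_at_of_maxFormBound_at hv hL
    (fun η hη hsymm =>
      periodicGroundStateEnergy_le_maxForm_of_hardCore hL hv.1 ha haL hcoreV (v' := (Set.Ioi a).indicator v)
        (hv.1.indicator measurableSet_Ioi) (fun _ hρ => (Set.indicator_of_mem (Set.mem_Ioi.2 hρ) v).symm)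
        (fun ρ => Set.indicator_le_self _ _ ρ) htail hfin η hη (mem_boseSymmetric.2 hsymm))
    hfin hε

/-- **`TruncationLimit` at `(v, N, L)` for a hard core with integrable tail profile**: `v` admissible,
`v = +∞` on `[0, a]` (`0 < a`), `∫_{ℝ³} (v 𝟙_{(a,∞)})(|z|) dz < ∞`, `0 < L`, `2a < L`, `E₀(v) < ∞`; then
`E₀(v) ≤ E₀(min(v,n)) + ε` for all large `n` (the tail interaction is integrable on every cell,
`lintegral_cellN_periodicInteraction_ne_top`). [folklore] -/
theorem truncationLimit_at_of_hardCore_profile {v : ℝ → ℝ≥0∞} (hv : IsRepulsiveFiniteRange v) {a : ℝ}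
    (ha : 0 < a) (hcoreV : ∀ r : ℝ, 0 ≤ r → r ≤ a → v r = ⊤)
    (hint : (∫⁻ z : Space, (Set.Ioi a).indicator v ‖z‖) ≠ ⊤) {N : ℕ} {L : ℝ} (hL : 0 < L) (haL : 2 * a < L)
    (hfin : periodicGroundStateEnergy v N L ≠ ⊤) {ε : ℝ} (hε : 0 < ε) :
    ∃ n₁ : ℕ, ∀ n : ℕ, n₁ ≤ n →
      (periodicGroundStateEnergy v N L).toReal ≤
        (periodicGroundStateEnergy (truncPotential v n) N L).toReal + ε :=
  truncationLimit_at_of_hardCore hv ha hcoreV hL (by rw [div_lt_iff₀ hL]; linarith)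
    (PeriodicIRBound.LinearPhFloorWagner.WF.lintegral_cellN_periodicInteraction_ne_top hL
      (hv.1.indicator measurableSet_Ioi) hint N) hfin hε

/-! ### Registered-shape sub-goal -/

/-- **Sub-goal `stub_truncationLimitHardCore`** (item stmt-AtomisticToContinuum-9481, line
`force-balance-constitutive`, towards stub S4 `stub_truncationLimit : TruncationLimit`): the registered statement
`TruncationLimit` for the hard-core-plus-integrable-tail class — `v = +∞` on `[0, a]` (`0 < a`),
`∫_{ℝ³} (v 𝟙_{(a,∞)})(|z|) dz < ∞`, boxes of side `L > 2a`. Together with `stub_truncationLimit_integrable`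
(integrable profiles) this covers every admissible `v` that is either `L¹` or a solid hard core with `L¹` tail.
[folklore] -/
theorem stub_truncationLimitHardCore :
    ∀ v : ℝ → ℝ≥0∞, IsRepulsiveFiniteRange v → ∀ a : ℝ, 0 < a → (∀ r : ℝ, 0 ≤ r → r ≤ a → v r = ⊤) →
      (∫⁻ z : Space, (Set.Ioi a).indicator v ‖z‖) ≠ ⊤ → ∀ (N : ℕ) (L : ℝ), 0 < L → 2 * a < L →
      periodicGroundStateEnergy v N L ≠ ⊤ →
      ∀ ε : ℝ, 0 < ε → ∃ n₁ : ℕ, ∀ n : ℕ, n₁ ≤ n →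
        (periodicGroundStateEnergy v N L).toReal ≤
          (periodicGroundStateEnergy (truncPotential v n) N L).toReal + ε :=
  fun _v hv _a ha hcoreV hint _N _L hL haL hfin _ε hε =>
    truncationLimit_at_of_hardCore_profile hv ha hcoreV hint hL haL hfin hε

end Summit.AtomisticToContinuum.BoseEinsteinCondensation.Cruxes.DensityResponse.ForceBalanceConstitutive

end
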